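import Summits.KontsevichZagierPeriods.Zeta5Search.LaiSweepShard

/-!
# `κ₃` sweep certificate — shard file 052 of 127 (shards 364–370 of 889)

HONEST FRAMING. Systematic search; no irrationality claim unless certified. This file only checks,
by `decide +kernel`, shards 364–370 of the order-cell sweep of the `κ₃` point `(74, 2180, 444; δ74)`
(engine `LaiSweepEngine`, soundness `LaiSweepJump/Free/Eval/Shard/Kappa3`; a shard is `⟨regime, n,
p, q, p', q', Lo, Up⟩`: `n` cells from `p/q` to `p'/q'` with integer rate sums in `[Lo, Up]`, `K =
128`, `D = 2^40`). It draws NO conclusion: only the capstone `LaiKappa3SweepCert`, which needs all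
127 shard files, does. Kernel cost of this file ≈ 560 cells × 0.3 s.
-/

namespace Summit.KontsevichZagierPeriods.Zeta5Search.Sweep

set_option maxHeartbeats 100000000 in
/-- Shard 364: 80 cells of regime B from `86/253` to `1639/4804`.
[cite: Lai2024BallRivoal, §4 Lemma 4.3] -/
theorem shard364 :
    Shard.check 128 (2^40)
      ⟨true, 80, 86, 253, 1639, 4804, 20257729036927, 22180449079257⟩ = true := by
  decide +kernel

set_option maxHeartbeats 100000000 in
/-- Shard 365: 80 cells of regime B from `1639/4804` to `1645/4804`.
[cite: Lai2024BallRivoal, §4 Lemma 4.3] -/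
theorem shard365 :
    Shard.check 128 (2^40)
      ⟨true, 80, 1639, 4804, 1645, 4804, 20132475822833, 22058975614708⟩ = true := by
  decide +kernel

set_option maxHeartbeats 100000000 in
/-- Shard 366: 80 cells of regime B from `1645/4804` to `111/323`.
[cite: Lai2024BallRivoal, §4 Lemma 4.3] -/
theorem shard366 :
    Shard.check 128 (2^40)
      ⟨true, 80, 1645, 4804, 111, 323, 19768367878119, 21675153884279⟩ = true := by
  decide +kernel

set_option maxHeartbeats 100000000 in
/-- Shard 367: 80 cells of regime B from `111/323` to `109/316`.
[cite: Lai2024BallRivoal, §4 Lemma 4.3] -/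
theorem shard367 :
    Shard.check 128 (2^40)
      ⟨true, 80, 111, 323, 109, 316, 20557239377433, 22556782899352⟩ = true := by
  decide +kernel

set_option maxHeartbeats 100000000 in
/-- Shard 368: 80 cells of regime B from `109/316` to `134/387`.
[cite: Lai2024BallRivoal, §4 Lemma 4.3] -/
theorem shard368 :
    Shard.check 128 (2^40)
      ⟨true, 80, 109, 316, 134, 387, 21032011573406, 23094685545315⟩ = true := by
  decide +kernel

set_option maxHeartbeats 100000000 in
/-- Shard 369: 80 cells of regime B from `134/387` to `1669/4804`.
[cite: Lai2024BallRivoal, §4 Lemma 4.3] -/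
theorem shard369 :
    Shard.check 128 (2^40)
      ⟨true, 80, 134, 387, 1669, 4804, 18565676041241, 20400667727205⟩ = true := by
  decide +kernel

set_option maxHeartbeats 100000000 in
/-- Shard 370: 80 cells of regime B from `1669/4804` to `144/413`.
[cite: Lai2024BallRivoal, §4 Lemma 4.3] -/
theorem shard370 :
    Shard.check 128 (2^40)
      ⟨true, 80, 1669, 4804, 144, 413, 19851771927802, 21829540894300⟩ = true := by
  decide +kernel

/-- The checked shards of this file, in order. [folklore] -/
def shards052 : List (CheckedShard 128 (2^40)) :=
  [⟨_, shard364⟩, ⟨_, shard365⟩, ⟨_, shard366⟩, ⟨_, shard367⟩, ⟨_, shard368⟩,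
    ⟨_, shard369⟩, ⟨_, shard370⟩]

end Summit.KontsevichZagierPeriods.Zeta5Search.Sweep
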